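import Summits.CriticalPhenomena.PercolationContinuityZ3.Theorems.PercNearOneGluingNoHeavyLowerTailSahiC3CubeColourCheck

/-!
# Kahn's Conjecture 5 on `{0,1}^5`: the coloured-antichain check, chunk A (first point `q' = 3`) — COMPUTATIONAL (`native_decide`)

Support file (cell `prim-sahi`, seat `prim-sahi-typer` gen 27; `--supports stmt-CriticalPhenomena-4575`; COMPUTATIONAL).  One piece of the
evaluation of `colourCheck 5 19` (…`SahiC3CubeColourCheck`): the three colour branches of `goCC` for the antichains of the `5`-cube whose
FIRST point (in the order `0 … 31` of the bitmask encoding) is `q'`, for the `q'` listed — first point `q' = 3`.  The chunks are assembled in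
…`SahiC3CubeFive` (`colourCheck_of_branches`).  Work split (leaves = 3-colourings): `q' = 3` and `q' = 7` carry `33.8 %` each, the rest `32.4 %`.
[this work]
-/

namespace Summit.CriticalPhenomena.PercolationContinuityZ3.Theorems.SahiC3Cube

open OneCutCert CovTransferCert

/-- Chunk A of `colourCheck 5 19`: first point `q' = 3` (compiled evaluation). [this work] -/
theorem colourChunk_five_a : ([3] : List ℕ).all (fun q' =>
    goCC 19 5 (krT 19 5 (fullN 5)) (offT 19 5) (offT 19 5).toNat (2 ^ 5 - (q' + 1)) (q' + 1) (0 ||| coneN 5 q') (0 ||| belowN 5 q') 0 0 &&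
      goCC 19 5 (krT 19 5 (fullN 5)) (offT 19 5) (offT 19 5).toNat (2 ^ 5 - (q' + 1)) (q' + 1) (0 ||| coneN 5 q') 0 (0 ||| belowN 5 q') 0 &&
        goCC 19 5 (krT 19 5 (fullN 5)) (offT 19 5) (offT 19 5).toNat (2 ^ 5 - (q' + 1)) (q' + 1) (0 ||| coneN 5 q') 0 0 (0 ||| belowN 5 q')) = true := by
  native_decide

end Summit.CriticalPhenomena.PercolationContinuityZ3.Theorems.SahiC3Cube
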